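import Summits.BirchSwinnertonDyer.BirchSwinnertonDyer.Theorems.SignedLowerHalvesSmallImageLowerHalfBothSignsRttD2SeqJ3Junction
import Summits.BirchSwinnertonDyer.BirchSwinnertonDyer.Theorems.SignedLowerHalvesSmallImageLowerHalfBothSignsRttD2SeqJ3Strict
import HarnessLib

/-!
# Route `SignedLowerHalves`, crux L `SmallImageLowerHalfBothSigns` (stmt-BirchSwinnertonDyer-23599), line `rtt_w3` v14 → v15 — E2, row J3 ↔ J2⁺ coupling:
# THE STRICT CARRIER AT THE IWASAWA LEVEL — `b ∈ B′ ↔` every layer `proj_{n,k} b` has ALL its localisations above `S₀` equal to zero (the `n′ ≤ n` clause of `strictLevel` disappears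
# by norm-compatibility); hence `B′ = ker loc` for ANY Iwasawa-level `loc` whose vanishing means exactly that (junction-1's `Exact ιB loc`)

WIDTH seat `bsd-line-slh-p3-w3` g22 under LEAD `cruxlead-stmt-BirchSwinnertonDyer-23599` g11 (cell `bsd-ssimc`); helper `--supports stmt-BirchSwinnertonDyer-23599`. THEOREMS ONLY.
HONEST FRAMING: bookkeeping for the LEAD's coupling (KEY 20:11:55Z) `Function.Exact ιB loc` ⟺ `strictCarrier = ker loc`; nothing about E2 / crux L / BSD, which remain OPEN and
are proved for NO curve.

* ★ `mem_strictCarrier_strictLevel_iff` — `b ∈ strictCarrier I (strictLevel …) ↔ ∀ n k, ∀ w ∈ S₀, ∀ δ, locNK w n k (conj_δ (proj_{n,k} b)) = 0`;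
* ★ `exact_subtype_of_ker_eq` — for a `Λ_𝒪`-linear `loc : I.H →ₗ Hloc` with `loc b = 0 ↔` (that condition), `Function.Exact B′.subtype loc`.
References: [PerrinRiou1987] §4; [NeukirchSchmidtWingberg2008] (8.6.2)–(8.6.3); [Rubin2000] Thm. 1.7.3.
-/

set_option autoImplicit false
set_option linter.dupNamespace false -- D-0017: single-problem summit, the namespace repeats the problem name by design
noncomputable section

open scoped Classical
open NumberField IsDedekindDomain Field

namespace Summit.BirchSwinnertonDyer.BirchSwinnertonDyer.Theorems.SmallImageRttD2Seq

open Literature.NumberTheory.EllipticCurves Literature.NumberTheory.GaloisRepresentations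
  Literature.NumberTheory.ComplexMultiplication.EllipticUnits.JohnsonLeungKings2011
  Summit.BirchSwinnertonDyer.BirchSwinnertonDyer.Theorems.SmallImageRttD2J1

section Carrier

variable {K : Type} [Field K] [NumberField K] {p : ℕ} [Fact p.Prime] (S : Set (PadicAlgCl p)) {κ : ZpExtension K p}
  {γB : absoluteGaloisGroup K} {θ' : absoluteGaloisGroup K →ₜ* (padicCoeffIntegers S)ˣ} {P : Set (HeightOneSpectrum (𝓞 K))}
  (I : CycIwasawaCohomologyDataO S κ γB θ' P 1) (S₀ : Set (HeightOneSpectrum (𝓞 K)))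

/-- ★ **The strict carrier at the Iwasawa level**: a norm-compatible family is strict iff EVERY layer has all its localisations above `S₀` zero — the clause `n′ ≤ n` of `strictLevel`
is absorbed by `proj_{n′,k} = cor_{n→n′} ∘ proj_{n,k}`. [cite: PerrinRiou1987, §4] [cite: NeukirchSchmidtWingberg2008, (8.6.2)–(8.6.3)] -/
theorem mem_strictCarrier_strictLevel_iff (b : I.H) :
    b ∈ strictCarrier I (strictLevel S κ θ' P S₀) (fun n k f _ hy ↦ smul_mem_strictLevel S κ θ' P S₀ γB n k f hy) ↔
      ∀ (n k : ℕ) (w : HeightOneSpectrum (𝓞 K)), w ∈ S₀ → ∀ δ : absoluteGaloisGroup K,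
        locNK S κ θ' P w n k (cycLayerConjO S κ θ' P n k 1 δ (I.proj n k b)) = 0 := by
  rw [mem_strictCarrier_iff]
  constructor
  · intro hb n k w hw δ
    exact locNK_conj_eq_zero_of_mem_strictLevel S κ θ' P S₀ (hb n k) hw δ
  · intro hb n k n' h w hw δ
    rw [← proj_eq_cycCoresLE S κ θ' P 1 I b h k]
    exact hb n' k w hw δ

/-- ★ **`Function.Exact ιB loc` from `ker loc = B′`**: for any additive `loc` out of `I.H` whose kernel is described by the vanishing of all localisations above `S₀` of all layers,
the inclusion of the strict carrier and `loc` form an exact pair (the LEAD's four-term socket p784625). [cite: Rubin2000, Thm. 1.7.3] [cite: PerrinRiou1987, §4] -/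
theorem exact_subtype_of_ker_eq {Hloc : Type*} [AddCommGroup Hloc] (loc : I.H →+ Hloc)
    (hloc : ∀ b : I.H, loc b = 0 ↔ ∀ (n k : ℕ) (w : HeightOneSpectrum (𝓞 K)), w ∈ S₀ → ∀ δ : absoluteGaloisGroup K,
      locNK S κ θ' P w n k (cycLayerConjO S κ θ' P n k 1 δ (I.proj n k b)) = 0) :
    Function.Exact (strictCarrier I (strictLevel S κ θ' P S₀) (fun n k f _ hy ↦ smul_mem_strictLevel S κ θ' P S₀ γB n k f hy)).subtype loc := by
  intro b
  rw [hloc, ← mem_strictCarrier_strictLevel_iff S I S₀ b]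
  constructor
  · intro hb
    exact ⟨⟨b, hb⟩, rfl⟩
  · rintro ⟨b', rfl⟩
    exact b'.2

end Carrier

end Summit.BirchSwinnertonDyer.BirchSwinnertonDyer.Theorems.SmallImageRttD2Seq

end
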